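import Summits.CriticalPhenomena.PercolationContinuityZ3.Theorems.Transplant.SkelConcFaceStep
import Summits.CriticalPhenomena.PercolationContinuityZ3.Theorems.Transplant.SkelWinChainT
import HarnessLib

/-!
# L6 (F), part 3 — the face step `cond_j` AS A WINDOW TARGET STEP: the packaging record `Skel.faceStepW : Skel.WinStepData V` (stmt-g7's
# `SkelWinChainT`, generic twin of `BoxProdZ2.faceStep : TubeStepData W`) and every NON-KIT clause of the face obligation `Skel.FaceOblAt`
# for it, over the cell geometry of record (SHEAR-SCOPE §3.9 Layer 6 (F); generic re-typing of `BoxProdZ2ConcFace` §1 and of the clause list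
# of `faceOblAt_concG` §3)

builds on p205010 (kernel theorem, internal audit signed; external expert review pending) — nothing in this file uses p205010.
Lane `prim-bschramm`, typed by the `prim-hp-8` lineage (gen 24); helper file (`--supports stmt-CriticalPhenomena-4575 --as helper`).
NEW FILE over `SkelConcFaceStep` (part 2) and `SkelWinChainT` (stmt-g7).

The step: window depth `Rπ := rE_{a'}(x, du)` (forced, see part 1), source box = the shifted face row `[faceLo, faceHi]` (planar level
`5r + 10 s (j+1) − 1`, transverse `2r`), planar region `Dpl := farAS x du j`, region `Rg = Win w₀ (farAS x du j) rE`, true target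
`T' = M_{a'}(x + du)` (the span), enlarged target `T = T' ∪ Rim` with `Rim = {v ∈ Rg : d_G(w₀, v) > Rt − L'}`, `Rt = rM_{a'}(x + du)`, levels
`j₀ = M + 1 … j₁ = Rlev`, source = window centre = the root `w₀`, support `Sfin = Sx`.
* `faceStepW`, `faceStepW_Rg/_root/_T`; **`faceStepW_encl`** (`Rlev + 4 ≤ 10 s`: one unit more than the product's `Rlev + 3 ≤ 10 s`, the price
  of the shrunk region), `faceStepW_T_subset_Rg` (`j ≤ K`), `faceStepW_T_sdiff_subset` (`T ∖ T' ⊆ Rim`), `Face_subset_faceStepW_X_zero`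
  (`F^{j+1} ⊆ X_0`), `isSubbox_faceStepW` / `faceStepW_Rg_subset_Sfin` / `root_not_mem_faceStepW_Rg` / `root_mem_faceStepW_Sfin` /
  `finSupp_faceStepW` (from part 2 and `KSchA.finSupp_Wt`), **`rim_excess_faceStepW`** (`P_{Wt}(⋃_{t ∈ T ∖ T'} root ↔ t) ≤ η`), and the
  target-nonemptiness device `M_nonempty_of_offset_le` (a vertex over `cen (x + du)` within depth `rM` by (ι) `step`, once `rM` dominates the
  planar ℓ¹-offset of that centre from `φ w₀`); planar room for the kit clause: `faceRow_hwide` (level boxes wide from `M + 1`),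
  `winLevel_faceRow_subset_Win` (levels `j' ≤ 10 s − 3` inside the region).
The per-level KIT clause (product `hkits_face`, needing the L5 kit layer) and the final `faceOblAt` assembly are part 4 (`SkelConcFace`).
[cite: KozmaNitzan2024, §4 p. 27 ((30)), p. 30 (Step III), Lemma 10 (p. 17), Lemma 12 (p. 24)]
-/

noncomputable section

open MeasureTheory
open scoped Classical

namespace Summit.CriticalPhenomena.PercolationContinuityZ3.Theorems

namespace Transplant

namespace Skel

open Literature.Probability.Percolation Literature.Probability.LatticeModels SimpleGraph KNCells KNLevels GadgetSystem Contour
open Literature.Probability.Percolation.KozmaNitzan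
open Literature.Probability.Percolation.KozmaNitzan.Cells (oth oth_ne sgOf sgOf_sign stepVec_apply_fst stepVec_apply_oth eq_oth_of_ne oth_oth)
open Literature.Barriers.CriticalPhenomena (graphBall graphBall_finite mem_graphBall_self graphBall_mono)
open BoxProdZ2 (ConcRadiiG)
open PlanarSkeletonConc

variable {V : Type} [DecidableEq V] {G : SimpleGraph V} [G.LocallyFinite] (Φ : PlanarSkeletonConc G)

/-! ## §1 The window target step of the face `(x, du, j)` at anchor `a'` -/

/-- **The face step of `cond_j` as a window target step**: depth `rE_{a'}(x, du)`, source box = the shifted face row, planar region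
`farAS x du j`, target `M_{a'}(x + du) ∪ Rim` (`Rim` = the region beyond depth `rM_{a'}(x + du) − L'`), levels `[M + 1, Rlev]`, source `w₀`.
[cite: KozmaNitzan2024, §4 p. 30 (Step III)] -/
def faceStepW (C : PCells) (w₀ : V) (Λ : ConcRadiiG) (a' : ℕ) (x : Site 2) (du : MDir) (j Rlev N M L' : ℕ) (Sfin : Finset V) :
    WinStepData V where
  Rπ := Λ.rE a' x du
  lo := C.faceLo x du j
  hi := C.faceHi x du j
  Dpl := C.farAS x du j
  T := (cellGeomSG Φ C w₀ Λ).M a' (x + stepVec du) ∪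
    (Φ.Win w₀ (C.farAS x du j) (Λ.rE a' x du)).filter fun v => v ∉ graphBall G w₀ (Λ.rM a' (x + stepVec du) - L')
  Rlev := Rlev
  N := N
  j₀ := M + 1
  j₁ := Rlev
  root := w₀
  Sfin := Sfin

section Clauses

variable (C : PCells) (w₀ : V) (Λ : ConcRadiiG) (a' : ℕ) (x : Site 2) (du : MDir) (j Rlev N M L' : ℕ) (Sfin : Finset V)

/-- The region of the face step is the window over the shrunk far rows. [folklore] -/
theorem faceStepW_Rg : (faceStepW Φ C w₀ Λ a' x du j Rlev N M L' Sfin).Rg Φ = Φ.Win w₀ (C.farAS x du j) (Λ.rE a' x du) := rfl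

/-- The source of the face step is the root. [folklore] -/
theorem faceStepW_root : (faceStepW Φ C w₀ Λ a' x du j Rlev N M L' Sfin).root = w₀ := rfl

/-- The target of the face step. [folklore] -/
theorem faceStepW_T : (faceStepW Φ C w₀ Λ a' x du j Rlev N M L' Sfin).T = (cellGeomSG Φ C w₀ Λ).M a' (x + stepVec du) ∪
    (Φ.Win w₀ (C.farAS x du j) (Λ.rE a' x du)).filter fun v => v ∉ graphBall G w₀ (Λ.rM a' (x + stepVec du) - L') := rfl

/-- **The planar enclosure of the levels**: `[lo − (Rlev+1), hi + (Rlev+1)] ⊆ farAS x du j` for `Rlev + 4 ≤ 10 s`, `j + 1 ≤ K`.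
[cite: KozmaNitzan2024, §4 Lemma 10 (p. 17: B⟨R+1⟩ ⊆ D), p. 30] -/
theorem faceStepW_encl {j Rlev : ℕ} (hj : j + 1 ≤ C.K) (hRlev : Rlev + 4 ≤ 10 * C.s) (N M L' : ℕ) (Sfin : Finset V) :
    let P := faceStepW Φ C w₀ Λ a' x du j Rlev N M L' Sfin
    Finset.Icc (P.lo - ((P.Rlev + 1 : ℕ) : Site 2)) (P.hi + ((P.Rlev + 1 : ℕ) : Site 2)) ⊆ P.Dpl :=
  C.faceRow_enlarge_subset_farAS x du hj (show Rlev + 1 + 3 ≤ 10 * C.s by omega)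

variable {C Λ j} in
/-- **`T ⊆ Rg`** (`j ≤ K`, `rM ≤ rE`). [cite: KozmaNitzan2024, §4 Lemma 10 (p. 17: T ⊆ D)] -/
theorem faceStepW_T_subset_Rg (hW : Λ.WF C) (hj : j ≤ C.K) :
    (faceStepW Φ C w₀ Λ a' x du j Rlev N M L' Sfin).T ⊆ (faceStepW Φ C w₀ Λ a' x du j Rlev N M L' Sfin).Rg Φ :=
  Finset.union_subset (M_subset_Win_farAS Φ C w₀ hW x du hj) (Finset.filter_subset _ _)

/-- `T ∖ M_{a'}(x + du)` lies in the rim. [folklore] -/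
theorem faceStepW_T_sdiff_subset :
    (faceStepW Φ C w₀ Λ a' x du j Rlev N M L' Sfin).T \ (cellGeomSG Φ C w₀ Λ).M a' (x + stepVec du) ⊆
      (Φ.Win w₀ (C.farAS x du j) (Λ.rE a' x du)).filter fun v => v ∉ graphBall G w₀ (Λ.rM a' (x + stepVec du) - L') := by
  intro t ht
  obtain ⟨ht1, ht2⟩ := Finset.mem_sdiff.1 ht
  rcases Finset.mem_union.1 ht1 with h' | h'
  · exact absurd h' ht2
  · exact h'

variable {C Λ} in
/-- **`F^{j+1} ⊆ X_0`**: the face of record at level `j + 1` lies in the zeroth window level of the face step. [cite: KozmaNitzan2024, §4 p. 30] -/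
theorem Face_subset_faceStepW_X_zero (hW : Λ.WF C) :
    (faceDataSG Φ C w₀ Λ).Face a' x du (j + 1) ⊆ ((faceStepW Φ C w₀ Λ a' x du j Rlev N M L' Sfin).Lv Φ).X 0 := by
  rw [WinStepData.Lv_X]
  have h0 : ∀ t : Site 2, t - ((0 : ℕ) : Site 2) = t := fun t => by simp
  have h0' : ∀ t : Site 2, t + ((0 : ℕ) : Site 2) = t := fun t => by simp
  rw [h0, h0']
  exact Face_subset_Win_faceRow Φ C w₀ hW a' x du j

/-- The target is nonempty as soon as the true target `M_{a'}(x + du)` is. [folklore] -/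
theorem faceStepW_T_nonempty (hM : ((cellGeomSG Φ C w₀ Λ).M a' (x + stepVec du)).Nonempty) :
    (faceStepW Φ C w₀ Λ a' x du j Rlev N M L' Sfin).T.Nonempty :=
  hM.mono Finset.subset_union_left

variable {Λ a'} in
/-- **Target nonemptiness from (ι) `step`**: `M_{a'}(v)` (a span) contains a vertex over `cen v` once `rM_{a'}(v)` exceeds the planar ℓ¹-offset
of `cen v` from `φ w₀` (p2-g3's column device `exists_mem_VWin_φ_eq`). [cite: KozmaNitzan2024, §4 p. 26 ((29): the column inside Q_x)] -/
theorem M_nonempty_of_offset_le (v : Site 2)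
    (hR : (C.cen v 0 - Φ.φ w₀ 0).natAbs + (C.cen v 1 - Φ.φ w₀ 1).natAbs + 1 ≤ Λ.rM a' v) :
    ((cellGeomSG Φ C w₀ Λ).M a' v).Nonempty := by
  have hr := C.one_le_r
  have hc : C.cen v ∈ C.M v := by
    rw [PCells.M, C.mem_sq_iff]; intro i; constructor <;> omega
  have hc' : C.cen v + Pi.single (0 : Fin 2) ((1 : ℤˣ) : ℤ) ∈ C.M v := by
    rw [PCells.M, C.mem_sq_iff]
    intro i
    fin_cases i
    · simp; omega
    · simp
  obtain ⟨y, hy, -⟩ := exists_mem_VWin_φ_eq (Φ := Φ) hc hc' hR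
  exact ⟨y, hy⟩


/-! ### Planar room of the level boxes (for the kit clause, part 5) -/

omit [DecidableEq V] [G.LocallyFinite] in
/-- **The level boxes of the face step are wide from level `M + 1` on**: every side of `[faceLo − j', faceHi + j']` has length `≥ 2M + 2`
(the face row has extent `0` along the axis and `4r` across). [cite: KozmaNitzan2024, §4 p. 19 (windows)] -/
theorem faceRow_hwide (C : PCells) (x : Site 2) (du : MDir) (j : ℕ) {M j' : ℕ} (hj' : M + 1 ≤ j') :
    ∀ k, (C.faceLo x du j - (j' : Site 2)) k + 2 * M + 2 ≤ (C.faceHi x du j + (j' : Site 2)) k := by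
  intro k
  have hj'' : (M : ℤ) + 1 ≤ j' := by exact_mod_cast hj'
  unfold PCells.faceLo PCells.faceHi
  simp only [Pi.sub_apply, Pi.add_apply, Pi.natCast_apply, sLo, sHi]
  by_cases hk : k = du.1
  · subst hk; simp only [if_true]; split_ifs <;> omega
  · simp only [hk, if_false]; have := C.one_le_r; omega

omit [DecidableEq V] in
/-- **The window levels `j' ≤ 10 s − 3` of the face step lie in its region** (any depth). [cite: KozmaNitzan2024, §4 p. 30] -/
theorem winLevel_faceRow_subset_Win {j : ℕ} (hj : j + 1 ≤ C.K) {j' : ℕ} (hj' : j' + 3 ≤ 10 * C.s) (R : ℕ) :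
    winLevel Φ w₀ R (C.faceLo x du j) (C.faceHi x du j) j' ⊆ Φ.Win w₀ (C.farAS x du j) R :=
  Φ.Win_mono (C.faceRow_enlarge_subset_farAS x du hj hj') le_rfl

end Clauses

/-! ## §2 The clauses that need the history: subbox, support, root, rim excess -/

section History

variable {C : PCells} {w₀ : V} {Λ : ConcRadiiG} {S : KSchA V ℕ}
variable (hΓ : S.Γ = cellGeomSG Φ C w₀ Λ) (hΛ : WFS C Λ)
variable {h : ProbeHistory V} {e : Site 2 × MDir} (hV : S.Valid₂ G h e) {a a' : ℕ} {du : MDir} (hdu : du ∈ S.onward G h (tgt e))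
variable {j : ℕ} {o : Finset (Sym2 V)} (Rlev N M L' : ℕ)

include hΓ hΛ hV hdu

/-- **The region of the face step is a subbox of `Wt` in its window graph.** [cite: KozmaNitzan2024, §4 p. 31 (D is a subbox of Ω)] -/
theorem isSubbox_faceStepW :
    let P := faceStepW Φ C w₀ Λ a' (tgt e) du j Rlev N M L' (S.Sx G h e a a' du)
    KNLevels.IsSubbox (winGraph G P.root P.Rπ) (S.Wt G h e a a' du j o) S.p (P.Rg Φ) :=
  isSubbox_Wt_faceWin Φ hΓ hΛ hV hdu

omit hV hdu in
/-- `Rg ⊆ Sfin = Sx`. [folklore] -/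
theorem faceStepW_Rg_subset_Sfin :
    let P := faceStepW Φ C w₀ Λ a' (tgt e) du j Rlev N M L' (S.Sx G h e a a' du)
    P.Rg Φ ⊆ P.Sfin :=
  Win_farAS_subset_Sx Φ hΓ hΛ

omit hΓ hΛ hdu in
/-- The root lies in the support. [folklore] -/
theorem root_mem_faceStepW_Sfin :
    S.Γ.root ∈ (faceStepW Φ C w₀ Λ a' (tgt e) du j Rlev N M L' (S.Sx G h e a a' du)).Sfin := by
  show S.Γ.root ∈ S.Sx G h e a a' du
  unfold KSchA.Sx
  exact Finset.mem_union_left _ (Finset.mem_union_left _ hV.root_mem)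

omit hΛ hV hdu in
/-- The source of the face step is the scheme's root. [folklore] -/
theorem faceStepW_root_eq : (faceStepW Φ C w₀ Λ a' (tgt e) du j Rlev N M L' (S.Sx G h e a a' du)).root = S.Γ.root := by
  rw [hΓ]; rfl

/-- The root lies off the region. [folklore] -/
theorem root_not_mem_faceStepW_Rg :
    (faceStepW Φ C w₀ Λ a' (tgt e) du j Rlev N M L' (S.Sx G h e a a' du)).root ∉
      (faceStepW Φ C w₀ Λ a' (tgt e) du j Rlev N M L' (S.Sx G h e a a' du)).Rg Φ := by
  rw [faceStepW_root_eq Φ hΓ]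
  exact root_not_mem_Win_farAS Φ hΓ hΛ hV hdu

omit hΓ hΛ hV hdu in
/-- `Wt` is finitely supported on `Sfin = Sx`. [cite: KozmaNitzan2024, §4 p. 28 (Ω)] -/
theorem finSupp_faceStepW :
    KNLevels.FinSupp (S.Wt G h e a a' du j o) (faceStepW Φ C w₀ Λ a' (tgt e) du j Rlev N M L' (S.Sx G h e a a' du)).Sfin :=
  KSchA.finSupp_Wt

/-- **The rim excess of the face step**: `P_{Wt}(⋃_{t ∈ T ∖ M_{a'}(x+du)} root ↔ t) ≤ η` from an excess radius `R₁ ≤ rM_{a'}(x+du) − L'` at the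
running parameter (entrance depth `R₀ + 1`, `R₀ ≥ rQ_a(x), sup ρ_{a'}(x, du, ·)`; planar diameter `50 r`).
[cite: KozmaNitzan2024, §4 Lemma 12 (p. 24)] [cite: MartineauSevero2019, Cor. 2.2] -/
theorem rim_excess_faceStepW [Countable V] {R₀ : ℕ} (hQ : Λ.rQ a (tgt e) ≤ R₀) (hρ : ∀ ℓ, Λ.ρ a' (tgt e) du ℓ ≤ R₀) {η : ℝ} {R₁ : ℕ}
    (hR₁ : ∀ R', R₁ ≤ R' → ∀ (Rw : ℕ) (D' A' : Finset V), (∀ d ∈ D', d ∈ graphBall G w₀ Rw) →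
      (∀ d ∈ D', ∀ d' ∈ D', Φ.φ d - Φ.φ d' ∈ box 2 (50 * C.r)) → A' ⊆ D' → (∀ a ∈ A', a ∈ graphBall G w₀ (R₀ + 1)) →
        (bondPercolation G S.p).real (excess G w₀ R' D' A') ≤ η)
    (hR : R₁ ≤ Λ.rM a' (tgt e + stepVec du) - L') :
    (prodBernoulli (S.Wt G h e a a' du j o)).real
      (⋃ t ∈ (faceStepW Φ C w₀ Λ a' (tgt e) du j Rlev N M L' (S.Sx G h e a a' du)).T \
          S.Γ.M a' (tgt e + stepVec du), openConn S.Γ.root t) ≤ η := by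
  have hroot : S.Γ.root = w₀ := by rw [hΓ]; rfl
  have hsub : (faceStepW Φ C w₀ Λ a' (tgt e) du j Rlev N M L' (S.Sx G h e a a' du)).T \ S.Γ.M a' (tgt e + stepVec du) ⊆
      (Φ.Win w₀ (C.farAS (tgt e) du j) (Λ.rE a' (tgt e) du)).filter
        fun v => v ∉ graphBall G w₀ (Λ.rM a' (tgt e + stepVec du) - L') := by
    rw [hΓ]; exact faceStepW_T_sdiff_subset Φ C w₀ Λ a' (tgt e) du j Rlev N M L' _
  rw [hroot]
  refine le_trans (measureReal_mono (Set.iUnion₂_subset fun t ht => ?_) (measure_ne_top _ _))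
    (rim_excess_face Φ hΓ hΛ hV hdu (j := j) (o := o) hQ hρ hR₁ hR)
  exact Set.subset_biUnion_of_mem (u := fun t => openConn w₀ t) (hsub ht)

end History

end Skel

end Transplant

end Summit.CriticalPhenomena.PercolationContinuityZ3.Theorems

end
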